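import Mathlib
import HarnessLib
import Summits.CriticalPhenomena.CardyFormulaZ2.Theses.CardyComplexCone

/-!
# Line `shift-coupling-phase-exact` for the crux `CardyComplexCone.EdgePrecompact`
(item stmt-CriticalPhenomena-11387) — CHECKED SKELETON (crux-plan, round 1)

Idea (card `Cruxes/EdgePrecompact/Ideas/shift-coupling-phase-exact.md`, triage r1: 3 × pass):
a same-class pair of corners `(v,f)`, `(v',f')` (`f - v = f' - v'`) is related by the lattice
translation `w = v - v'`, and translating the corner is the same as translating the Dobrushin
DATA: `E_{Λδ}(v',f') = E_{Λδ + δw}(v,f)` (`Sig.stub_translationCovariance`). Compare the data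
`Λ δ` and `Λ δ + δw` in ONE configuration `ω`: their explorations induce the same entrance /
response pattern on a fixed ball `B(δv, ρ)` — and then the corner functionals at `(v,f)` agree
for EVERY completion inside the ball — except on an EXTERIOR-measurable bad event `B`
(non-merging driven by the `|δw|`-collar of `∂D`, or a `2π` winding slip / re-rooting at a marked
point: the triage counterexamples) whose PROBABILITY is `≤ ε'` once `|δw| < η`
(`Sig.stub_shiftCouplingLocality`: coupling + topology + boundary three-arm / marked-point two-arm
sums; no phase is estimated there). The phase cancellation enters exactly once, through the
transfer target C⁺ = `Sig.stub_localInnerEnvelope`, typed — as the triage asked — in its CONDITIONED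
(multi-arc) form and at the weakest strength the composition uses: the normalised conditional
twisted amplitude `(ρ/δ)^{1/3} · E[F_{v,f} | configuration off B(δv,ρ)]` is uniformly integrable,
uniformly over admissible data, corners and radii:
`∀ ε₁ ∃ C : ‖E[F_{v,f} ; A]‖ ≤ (C·P(A) + ε₁)·(δ/ρ)^{1/3}` for every exterior-measurable `A`.
Composition: clause (i) is C⁺ with `A = univ`, `ρ = ρ_K`; clause (ii) is
`‖E(v,f) − E(v',f')‖ = ‖∫_B F₀ − ∫_B F₁‖ ≤ 2 (C ε' + ε₁)(δ/ρ)^{1/3} = ε δ^{1/3}`.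

Audit target: `EdgePrecompact_of : Sig.stub_translationCovariance → Sig.stub_localInnerEnvelope →
Sig.stub_shiftCouplingLocality → EdgePrecompact` (the route decl, by name; layer-invariant audit:
hypothesis heads = stub names); `sorry` only in the three registered `theorem stub_* : Sig.stub_*`.

Generation 2 (crux-plan g2, 2026-08-16): stubs and composition UNCHANGED (re-verified: lean check rc 0,
3 sorries = the stubs; `#h21_check_skeleton` ok, closed = true; `ledger skeleton check` OK 00:53:37Z);
ADDED the sorry-free bridge `shiftStability_of'` / `shiftStability_of` (last section): the three stubs —
indeed already admissibility transport + LIE + SCL — give the PICKED line's `ShiftStability`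
(`Lines/qkz-strip-boundary-arm.lean`, `stub_shiftStability : UniformInnerEnvelope → ShiftStability`)
outright, so this file is the typed split of that stub into its provable part (SCL) and its open
core (LIE). The skeleton registration slot of the item belongs to the picked line; this file is NOT
re-registered after the lead's pick.
Short names used in the prose: TC = translation covariance, LIE / C⁺ = local inner envelope,
SCL = shift-coupling locality. Disproof honoured (evidence abstracts v1–v4 of cdisprove; file itself not mounted in
this seat): interiority of `K` (`edgePrecompact_false_without_compactness_of_familyExists`) is
used at `hρK`/`hball` — LIE only ever sees balls `closedBall (δv) ρ ⊆ Ω` with `ρ ≥ δ`, never the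
start corner; `(Λ δ).Ω = D` and `(Λ δ).δ = δ` (`not_edgePrecompactWithoutDomainEq/MeshEq`) are
used at `hΩ`/`hδ` in both clauses.
-/

noncomputable section

namespace Summit.CriticalPhenomena.CardyFormulaZ2.Cruxes.EdgePrecompact.ShiftCouplingPhaseExact

open scoped BigOperators Topology Classical MeasureTheory ProbabilityTheory
open Filter Set MeasureTheory
open Literature.Probability.LatticeModels
open Literature.Probability.Percolation (BondConfig bondPercolation half)
open Summit.CriticalPhenomena.CardyFormulaZ2.Theses.CardyComplexCone (EdgePrecompact)

/-! ### The corner observable of one discrete Dobrushin datum (the crux's `E δ v f`, verbatim) -/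

/-- The phase functional of the crux at mesh `δ`, datum `E`, corner `(v,f)`, configuration `ω`:
`∑_{k : γ_k = cornerSource v f, γ_{k+1} = cornerTarget v f} exp (−(i/3)·winding (γ[0..k+1]))`,
`γ = medialExploration E ω` (verbatim the crux integrand with `Λ δ ↦ E`; definitionally equal, the
composition below rewrites the crux's `E δ v f` into `cornerObsAt δ (Λ δ) v f` by `change`). -/
def phaseFunctionalAt (δ : ℝ) (E : DiscreteDobrushin) (v f : Site 2) (ω : BondConfig (Site 2)) : ℂ :=
  (let γ := Literature.Probability.LatticeModels.medialExploration E ω; ∑ k ∈ (Finset.range γ.length).filter (fun k => γ[k]? = some (Literature.Probability.LatticeModels.cornerSource v f) ∧ γ[k + 1]? = some (Literature.Probability.LatticeModels.cornerTarget v f)), Complex.exp (-(Complex.I / 3) * ((Literature.Probability.LatticeModels.winding ((γ.map (Literature.Probability.LatticeModels.medialPoint δ)).take (k + 2)) : ℝ) : ℂ)))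

/-- The corner observable `E(v,f)` of the datum `E` at mesh `δ`: the `P_{1/2}`-expectation of
`phaseFunctionalAt` (verbatim the crux's `E δ v f` with `Λ δ ↦ E`). -/
def cornerObsAt (δ : ℝ) (E : DiscreteDobrushin) (v f : Site 2) : ℂ :=
  ∫ ω, phaseFunctionalAt δ E v f ω ∂(bondPercolation (zdGraph 2) half)

/-- The datum `E` translated by the lattice vector `w` (at its own mesh): domain and both arcs
move by `meshPoint E.δ w`; the mesh is unchanged. Its corner `(v + w, f + w)` is the translate of
the corner `(v, f)` of `E`. -/
def translateData (E : DiscreteDobrushin) (w : Site 2) : DiscreteDobrushin where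
  Ω := (fun x : ℂ => x + meshPoint E.δ w) '' E.Ω
  δ := E.δ
  arcA := (fun x : ℂ => x + meshPoint E.δ w) '' E.arcA
  arcB := (fun x : ℂ => x + meshPoint E.δ w) '' E.arcB

/-- The lattice edges (medial vertices) whose midpoint at mesh `δ` lies in the open ball
`B(z, ρ)`: the INSIDE of the ball. -/
def ballEdges (δ : ℝ) (z : ℂ) (ρ : ℝ) : Set (Sym2 (Site 2)) :=
  {e | Literature.Probability.LatticeModels.medialPoint δ e ∈ Metric.ball z ρ}

/-- The exterior σ-algebra of the ball `B(z, ρ)` at mesh `δ`: events that are measurable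
functions of the configuration restricted OFF `ballEdges δ z ρ` (pull-back of the product
σ-algebra on `Set (Sym2 (Site 2))` along `ω ↦ ω \ ballEdges δ z ρ`). -/
abbrev exteriorSigma (δ : ℝ) (z : ℂ) (ρ : ℝ) : MeasurableSpace (BondConfig (Site 2)) :=
  MeasurableSpace.comap (fun ω : BondConfig (Site 2) => ω \ ballEdges δ z ρ) inferInstance

/-! ### The three registered stubs

Each stub's statement is the `Prop` `Sig.stub_<name>` (its SIGNATURE) and the registered obligation is
`theorem stub_<name> : Sig.stub_<name> := by sorry`; `EdgePrecompact_of` takes the three signatures as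
hypotheses BY NAME. Obligation tags (`@[stub]`) are gate-stamped, not written here. -/

/-- STUB 1 — TRANSLATION COVARIANCE (provable now; size M–L: covariance has to be threaded
through `meshDomain` (largest components), `zdBoundary`, `zdDiscreteArc` (`frontier`/`infDist`),
`bcBondConfig`, `IsMedialExploration` and the `∃!`-choice in `medialExploration`, translation
invariance of `Polyline.winding` and of `bondPercolation (zdGraph 2) half` under `ω ↦ ω + w`).
Translating a discrete Dobrushin datum by a lattice vector `w` preserves `ℤ²`-admissibility and
carries the corner observable along: `E_{E + δw}(v + w, f + w) = E_E(v, f)`. The card's First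
lemma; triage: true, `IsZdAdmissible` hypothesis unnecessary (if `∃!` fails it fails for both). -/
def Sig.stub_translationCovariance : Prop :=
  ∀ (E : DiscreteDobrushin) (w : Site 2),
    ((translateData E w).IsZdAdmissible ↔ E.IsZdAdmissible) ∧
    ∀ v f : Site 2, cornerObsAt E.δ (translateData E w) (v + w) (f + w) = cornerObsAt E.δ E v f

/-- STUB 2 — LOCAL INNER ENVELOPE, the transfer target C⁺ (HARDEST stub; XL / open: it contains
clause (i) made scale-free and uniform in the data, and by the triage's necessity remark it sits
at the sharp boundary one-arm exponent of bond-`ℤ²`). For every `ε₁ > 0` one constant `C` such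
that for every admissible datum `E` (any bounded domain, any arcs, mesh `E.δ > 0`), every corner
`(v,f)`, every radius `ρ ≥ E.δ` with `closedBall (δv) ρ ⊆ E.Ω`, and every event `A` measurable
with respect to the configuration OFF the ball `B(δv, ρ)`:
`‖E[F_{v,f} ; A]‖ ≤ (C·P(A) + ε₁)·(E.δ/ρ)^{1/3}`.
Equivalently: the normalised conditional twisted amplitude `(ρ/δ)^{1/3}·E[F_{v,f} | exterior]`
is UNIFORMLY INTEGRABLE, uniformly in (data, corner, radius) — the conditioned / multi-arc form
the triage asked for, at the weakest strength the composition uses (it is implied by, and for a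
multi-scale proof is morally the same as, the sup-form `|E[F | any exterior pattern]| ≤
C (δ/ρ)^{1/3}`). With `A = univ` it is the scale-free envelope `‖E_E(v,f)‖ ≤ (C+ε₁)(δ/ρ)^{1/3}`.
Why it might fail: the sharp `1/3` itself (twisted two-arm cancellation `δ^{1/12}` on `ℤ²`,
no integrability), or rare exterior patterns (many alternating arms on the sphere) carrying
conditional amplitudes `≫ (δ/ρ)^{1/3}` with too much total mass. At `ρ = δ` it is the trivial
`|F| ≤ 1` (nodup). -/
def Sig.stub_localInnerEnvelope : Prop :=
  ∀ ε₁ > (0:ℝ), ∃ C : ℝ, ∀ (E : DiscreteDobrushin), E.IsZdAdmissible → 0 < E.δ →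
    ∀ v f : Site 2, IsCorner v f → ∀ ρ : ℝ, E.δ ≤ ρ →
      Metric.closedBall (meshPoint E.δ v) ρ ⊆ E.Ω →
      ∀ A : Set (BondConfig (Site 2)), MeasurableSet[exteriorSigma E.δ (meshPoint E.δ v) ρ] A →
        ‖∫ ω in A, phaseFunctionalAt E.δ E v f ω ∂(bondPercolation (zdGraph 2) half)‖
          ≤ (C * ((bondPercolation (zdGraph 2) half) A).toReal + ε₁) * (E.δ / ρ) ^ ((1:ℝ) / 3)

/-- STUB 3 — SHIFT-COUPLING LOCALITY, the card's lever (size L; RSW technology, no phase). For a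
discretisation family `Λ` of `D`, a compact `K ⊆ D` and a radius `ρ` with
`cthickening (2ρ) K ⊆ D`: for every `ε > 0` there is `η > 0` such that eventually in `δ`, for
every corner `(v,f)` with `δv ∈ K` and every lattice shift `w` with `‖δw‖ < η`, the difference
of the corner observables of the data `Λ δ` and `Λ δ + δw` at `(v,f)` (SAME configuration `ω`) is
CARRIED by an event `B`, measurable with respect to the configuration off the ball `B(δv, ρ)`,
of probability `≤ ε`:  `E₀(v,f) − E₁(v,f) = ∫_B F₀ − ∫_B F₁`.
Content (all inline, `--supports`): (a) `B :=` the exterior projection of the disagreement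
event (finite cylinder algebra ⇒ measurable); (b) the pathwise lemma "same entrance dart with
the same winding and the same exit ↦ re-entrance response of the two exterior explorations ⇒ the
same functional at `(v,f)` for every interior completion" — the triage-repaired topological lemma
(winding equality on the ordered-excursion event, NOT on bare passage: `2π` slips exist, cex
`ShiftCouplingWindingOffsetCex.md`, `example_deep_compact.txt`); (c) `P(B) → 0` as `η → 0`
uniformly in `δ` and in the arcs: boundary three-arm sum over the `η`-collar of `∂D` (universal
half-plane exponent 2, to be ported to bond-`ℤ²`; any exponent `> 1` suffices here) plus the
marked-point re-rooting (half-plane two-arm) bound for the slips.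
Why it might fail: for a Jordan domain with very rough (non-porous) boundary the collar box-count
beats the three-arm decay and (c) needs a screening argument not in print; `B` must be
exterior-measurable for the SAME ball for both data (it is: the ball is fixed, only the data
move). -/
def Sig.stub_shiftCouplingLocality : Prop :=
  ∀ (D : Literature.Probability.RandomPlanarGeometry.DobrushinDomain) (Λ : ℝ → DiscreteDobrushin),
    (∀ δ, (Λ δ).Ω = D.carrier) → (∀ δ, (Λ δ).δ = δ) →
    (∀ᶠ δ in 𝓝[>] (0:ℝ), (Λ δ).IsZdAdmissible) →
    ∀ K : Set ℂ, IsCompact K → K ⊆ D.carrier →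
    ∀ ρ > (0:ℝ), Metric.cthickening (2 * ρ) K ⊆ D.carrier →
    ∀ ε > (0:ℝ), ∃ η > (0:ℝ), ∀ᶠ δ in 𝓝[>] (0:ℝ), ∀ v f w : Site 2, IsCorner v f →
      meshPoint δ v ∈ K → ‖meshPoint δ w‖ < η →
      ∃ B : Set (BondConfig (Site 2)),
        MeasurableSet[exteriorSigma δ (meshPoint δ v) ρ] B ∧
        ((bondPercolation (zdGraph 2) half) B).toReal ≤ ε ∧
        cornerObsAt (Λ δ).δ (Λ δ) v f - cornerObsAt (Λ δ).δ (translateData (Λ δ) w) v f =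
          (∫ ω in B, phaseFunctionalAt (Λ δ).δ (Λ δ) v f ω ∂(bondPercolation (zdGraph 2) half)) -
          (∫ ω in B, phaseFunctionalAt (Λ δ).δ (translateData (Λ δ) w) v f ω ∂(bondPercolation (zdGraph 2) half))

/-- Registered stub 1 (translation covariance). -/
theorem stub_translationCovariance : Sig.stub_translationCovariance := by
  sorry

/-- Registered stub 2 (local inner envelope — transfer target C⁺, hardest). -/
theorem stub_localInnerEnvelope : Sig.stub_localInnerEnvelope := by
  sorry

/-- Registered stub 3 (shift-coupling locality — the lever). -/
theorem stub_shiftCouplingLocality : Sig.stub_shiftCouplingLocality := by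
  sorry

/-! ### Glue (elementary) -/

/-- `meshPoint` is additive in the site (used to turn `dist (δv) (δv')` into `‖δ(v − v')‖`). -/
theorem meshPoint_sub (δ : ℝ) (x y : Site 2) :
    meshPoint δ (x - y) = meshPoint δ x - meshPoint δ y := by
  apply Complex.ext <;> simp [mul_sub]

/-! ### The composition: the three stubs give the crux BY NAME -/

/-- The line: translation covariance + local inner envelope + shift-coupling locality imply
`CardyComplexCone.EdgePrecompact` (both clauses; (i) uses only the envelope). -/
theorem EdgePrecompact_of :
    Sig.stub_translationCovariance → Sig.stub_localInnerEnvelope → Sig.stub_shiftCouplingLocality →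
      EdgePrecompact := by
  intro hTC hLIE hSCL D Λ hΩ hδ hadm E K hK hKD
  -- a uniform inner radius for K (interiority of K is load-bearing: Disproof (a))
  obtain ⟨r, hr, hrK⟩ := hK.exists_cthickening_subset_open D.isOpen hKD
  set ρ : ℝ := r / 2 with hρdef
  have hρ : 0 < ρ := by positivity
  have h2ρ : 2 * ρ = r := by rw [hρdef]; ring
  have hρK : Metric.cthickening (2 * ρ) K ⊆ D.carrier := by rw [h2ρ]; exact hrK
  have hρK' : Metric.cthickening ρ K ⊆ D.carrier :=
    (Metric.cthickening_mono (by linarith) K).trans hρK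
  -- eventualities in δ
  have hpos : ∀ᶠ δ in 𝓝[>] (0:ℝ), 0 < δ := eventually_mem_nhdsWithin
  have hlt : ∀ᶠ δ in 𝓝[>] (0:ℝ), δ < ρ := (eventually_lt_nhds hρ).filter_mono nhdsWithin_le_nhds
  -- rpow algebra
  have hsplit : ∀ δ : ℝ, 0 < δ → (δ / ρ) ^ ((1:ℝ) / 3) = δ ^ ((1:ℝ) / 3) / ρ ^ ((1:ℝ) / 3) :=
    fun δ hδ0 => Real.div_rpow hδ0.le hρ.le _
  have hρ3 : 0 < ρ ^ ((1:ℝ) / 3) := Real.rpow_pos_of_pos hρ _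
  -- balls around points of K at the family's mesh lie in D
  have hballK : ∀ (δ : ℝ) (v : Site 2), meshPoint δ v ∈ K →
      Metric.closedBall (meshPoint δ v) ρ ⊆ D.carrier := fun δ v hvK x hx =>
    hρK' (Metric.mem_cthickening_of_dist_le x (meshPoint δ v) ρ K hvK (Metric.mem_closedBall.1 hx))
  refine ⟨?_, ?_⟩
  · -- clause (i): the envelope on K, from the local inner envelope with A = univ and ε₁ = 1
    obtain ⟨C, hC⟩ := hLIE 1 one_pos
    refine ⟨(C + 1) / ρ ^ ((1:ℝ) / 3), ?_⟩
    filter_upwards [hadm, hpos, hlt] with δ hadmδ hδpos hδρ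
    intro v f hvf hvK
    have hΛδ : (Λ δ).δ = δ := hδ δ
    have key := hC (Λ δ) hadmδ (by rw [hΛδ]; exact hδpos) v f hvf ρ (by rw [hΛδ]; exact hδρ.le)
      (by rw [hΛδ, hΩ]; exact hballK δ v hvK) Set.univ MeasurableSet.univ
    rw [Measure.restrict_univ, measure_univ, ENNReal.toReal_one, mul_one, hΛδ, hsplit δ hδpos] at key
    change ‖cornerObsAt δ (Λ δ) v f‖ ≤ (C + 1) / ρ ^ ((1:ℝ) / 3) * δ ^ ((1:ℝ) / 3)
    calc ‖cornerObsAt δ (Λ δ) v f‖ ≤ (C + 1) * (δ ^ ((1:ℝ) / 3) / ρ ^ ((1:ℝ) / 3)) := key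
      _ = (C + 1) / ρ ^ ((1:ℝ) / 3) * δ ^ ((1:ℝ) / 3) := by ring
  · -- clause (ii): same-class equicontinuity, from covariance + coupling locality + envelope
    intro ε hε
    set ε₁ : ℝ := ε * ρ ^ ((1:ℝ) / 3) / 4 with hε₁def
    have hε₁ : 0 < ε₁ := by positivity
    obtain ⟨C, hC⟩ := hLIE ε₁ hε₁
    set C₁ : ℝ := max C 1 with hC₁def
    have hC₁pos : 0 < C₁ := lt_of_lt_of_le one_pos (le_max_right _ _)
    have hCC₁ : C ≤ C₁ := le_max_left _ _
    set ε' : ℝ := ε * ρ ^ ((1:ℝ) / 3) / (4 * C₁) with hε'def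
    have hε' : 0 < ε' := by positivity
    obtain ⟨η, hη, hev⟩ := hSCL D Λ hΩ hδ hadm K hK hKD ρ hρ hρK ε' hε'
    refine ⟨min η ρ, lt_min hη hρ, ?_⟩
    filter_upwards [hev, hadm, hpos, hlt] with δ hevδ hadmδ hδpos hδρ
    intro v f v' f' hvf hv'f' hclass hvK hv'K hdist
    have hΛδ : (Λ δ).δ = δ := hδ δ
    -- the translation relating the two corners
    set w : Site 2 := v - v' with hwdef
    have hvw : v' + w = v := by rw [hwdef]; abel
    have hfw : f' + w = f := by
      rw [hwdef]
      have : f = f' + (v - v') := by linear_combination hclass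
      exact this.symm
    have hnormw : ‖meshPoint δ w‖ < min η ρ := by
      rw [hwdef, meshPoint_sub, ← dist_eq_norm]; exact hdist
    have hηw : ‖meshPoint δ w‖ < η := lt_of_lt_of_le hnormw (min_le_left _ _)
    have hρw : ‖meshPoint δ w‖ < ρ := lt_of_lt_of_le hnormw (min_le_right _ _)
    -- covariance: E δ v' f' is the observable of the translated datum at (v, f)
    obtain ⟨hadmT, hcov⟩ := hTC (Λ δ) w
    have hcov' : cornerObsAt δ (translateData (Λ δ) w) v f = cornerObsAt δ (Λ δ) v' f' := by
      have := hcov v' f'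
      rw [hvw, hfw, hΛδ] at this
      exact this
    -- coupling locality: the difference is carried by an exterior-measurable event B
    obtain ⟨B, hBmeas, hBprob, hBdiff⟩ := hevδ v f w hvf hvK hηw
    rw [hΛδ] at hBdiff
    -- the inner envelope on B, for the datum Λ δ …
    have key₀ := hC (Λ δ) hadmδ (by rw [hΛδ]; exact hδpos) v f hvf ρ (by rw [hΛδ]; exact hδρ.le)
      (by rw [hΛδ, hΩ]; exact hballK δ v hvK) B (by rw [hΛδ]; exact hBmeas)
    rw [hΛδ] at key₀
    -- … and for the translated datum Λ δ + δw (admissible by covariance; its ball is in D + δw)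
    have hδT : (translateData (Λ δ) w).δ = δ := hΛδ
    have hball₁ : Metric.closedBall (meshPoint δ v) ρ ⊆ (translateData (Λ δ) w).Ω := by
      intro x hx
      change x ∈ (fun y : ℂ => y + meshPoint (Λ δ).δ w) '' (Λ δ).Ω
      rw [hΩ, hΛδ]
      refine ⟨x - meshPoint δ w, ?_, by simp⟩
      apply hρK
      refine Metric.mem_cthickening_of_dist_le (x - meshPoint δ w) (meshPoint δ v) (2 * ρ) K hvK ?_
      calc dist (x - meshPoint δ w) (meshPoint δ v)
          ≤ dist (x - meshPoint δ w) x + dist x (meshPoint δ v) := dist_triangle _ _ _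
        _ = ‖meshPoint δ w‖ + dist x (meshPoint δ v) := by
            rw [dist_eq_norm]; congr 1; simp
        _ ≤ ρ + ρ := add_le_add hρw.le (Metric.mem_closedBall.1 hx)
        _ = 2 * ρ := by ring
    have key₁ := hC (translateData (Λ δ) w) (hadmT.2 hadmδ) (by rw [hδT]; exact hδpos) v f hvf ρ
      (by rw [hδT]; exact hδρ.le) (by rw [hδT]; exact hball₁) B (by rw [hδT]; exact hBmeas)
    rw [hδT] at key₁
    -- assemble
    change ‖cornerObsAt δ (Λ δ) v f - cornerObsAt δ (Λ δ) v' f'‖ ≤ ε * δ ^ ((1:ℝ) / 3)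
    rw [← hcov', hBdiff]
    have hP : ((bondPercolation (zdGraph 2) half) B).toReal ≤ ε' := hBprob
    have hP0 : 0 ≤ ((bondPercolation (zdGraph 2) half) B).toReal := ENNReal.toReal_nonneg
    have hX : 0 ≤ (δ / ρ) ^ ((1:ℝ) / 3) := Real.rpow_nonneg (div_nonneg hδpos.le hρ.le) _
    have hCP : C * ((bondPercolation (zdGraph 2) half) B).toReal ≤ C₁ * ε' :=
      (mul_le_mul_of_nonneg_right hCC₁ hP0).trans (mul_le_mul_of_nonneg_left hP hC₁pos.le)
    calc ‖(∫ ω in B, phaseFunctionalAt δ (Λ δ) v f ω ∂(bondPercolation (zdGraph 2) half)) -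
            (∫ ω in B, phaseFunctionalAt δ (translateData (Λ δ) w) v f ω ∂(bondPercolation (zdGraph 2) half))‖
        ≤ ‖∫ ω in B, phaseFunctionalAt δ (Λ δ) v f ω ∂(bondPercolation (zdGraph 2) half)‖ +
            ‖∫ ω in B, phaseFunctionalAt δ (translateData (Λ δ) w) v f ω ∂(bondPercolation (zdGraph 2) half)‖ :=
          norm_sub_le _ _
      _ ≤ (C * ((bondPercolation (zdGraph 2) half) B).toReal + ε₁) * (δ / ρ) ^ ((1:ℝ) / 3) +
            (C * ((bondPercolation (zdGraph 2) half) B).toReal + ε₁) * (δ / ρ) ^ ((1:ℝ) / 3) :=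
          add_le_add key₀ key₁
      _ ≤ (C₁ * ε' + ε₁) * (δ / ρ) ^ ((1:ℝ) / 3) + (C₁ * ε' + ε₁) * (δ / ρ) ^ ((1:ℝ) / 3) := by
          have := mul_le_mul_of_nonneg_right (add_le_add_right hCP ε₁) hX
          linarith
      _ = ε * δ ^ ((1:ℝ) / 3) := by
          rw [hsplit δ hδpos, hε'def, hε₁def]
          field_simp
          ring

/-- The skeleton in its final shape (D-0027 §3.3): the crux BY NAME from the three registered
stubs; it becomes the crux proof when the last `stub_*` is discharged (until then it depends on
`sorryAx` through the stubs only — no `sorry` of its own). -/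
theorem EdgePrecompact_proof : EdgePrecompact :=
  EdgePrecompact_of stub_translationCovariance stub_localInnerEnvelope stub_shiftCouplingLocality

/-! ### Bridge to the PICKED line `qkz-strip-boundary-arm` (crux-plan g2 addendum, 2026-08-16)

The lead picked `Lines/qkz-strip-boundary-arm.lean` (`PICKED.md`, 2026-08-16T00:50Z). Its stub
`QkzStripBoundaryArm.stub_shiftStability : UniformInnerEnvelope → ShiftStability` is THIS line's
lever, with — in the lead's and that planner's words — an "honest open core: the decoupling of the
non-merge event from the inner twisted amplitude". The three stubs of this file are exactly the typed
split of that stub: `Sig.stub_shiftCouplingLocality` (coupling + topology + boundary arm sums; no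
phase, size L) isolates the difference on an exterior-measurable event of small PROBABILITY, and
`Sig.stub_localInnerEnvelope` (the conditional / uniformly-integrable inner envelope) is the
decoupling itself. The kernel-checked theorem `shiftStability_of'` below derives `ShiftStability`
from these two plus only the admissibility transport `AdmissibilityTransport` (the first conjunct of
`Sig.stub_translationCovariance`; the qkz covariance stub omits it), WITHOUT `UniformInnerEnvelope`.

A crux workfile cannot import another workfile, so the qkz vocabulary is copied VERBATIM under
`Qkz.` (`Qkz.cornerObs`, `Qkz.shiftData`, `Qkz.ShiftStability` have the bodies of
`QkzStripBoundaryArm.cornerObs / shiftData / ShiftStability`, sha 4aff93d18d90 of that file); the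
dictionary `Qkz.cornerObs E δ v f = cornerObsAt δ E v f`, `Qkz.shiftData = translateData` is `rfl`, so
the lead can transplant `shiftStability_of'` into the picked skeleton by renaming only. -/

namespace Qkz

/-- VERBATIM copy of `QkzStripBoundaryArm.cornerObs` (the crux integrand read at mesh `δ`). -/
def cornerObs (E : DiscreteDobrushin) (δ : ℝ) (v f : Site 2) : ℂ :=
  ∫ ω, (let γ := Literature.Probability.LatticeModels.medialExploration E ω;
    ∑ k ∈ (Finset.range γ.length).filter (fun k => γ[k]? = some
      (Literature.Probability.LatticeModels.cornerSource v f) ∧ γ[k + 1]? = some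
      (Literature.Probability.LatticeModels.cornerTarget v f)), Complex.exp (-(Complex.I / 3) *
      ((Literature.Probability.LatticeModels.winding ((γ.map
      (Literature.Probability.LatticeModels.medialPoint δ)).take (k + 2)) : ℝ) : ℂ)))
    ∂(Literature.Probability.Percolation.bondPercolation (Literature.Probability.LatticeModels.zdGraph 2)
      Literature.Probability.Percolation.half)

/-- VERBATIM copy of `QkzStripBoundaryArm.shiftData` (= `translateData`, by `rfl`). -/
def shiftData (E : DiscreteDobrushin) (w : Site 2) : DiscreteDobrushin where
  Ω := (· + meshPoint E.δ w) '' E.Ω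
  δ := E.δ
  arcA := (· + meshPoint E.δ w) '' E.arcA
  arcB := (· + meshPoint E.δ w) '' E.arcB

/-- VERBATIM copy of `QkzStripBoundaryArm.ShiftStability` (the conclusion of the picked line's
`stub_shiftStability`; Disproof F8 "(ii) ⇔ translation stability"). -/
def ShiftStability : Prop :=
  ∀ (D : Literature.Probability.RandomPlanarGeometry.DobrushinDomain) (Λ : ℝ → DiscreteDobrushin),
    (∀ δ, (Λ δ).Ω = D.carrier) → (∀ δ, (Λ δ).δ = δ) →
    (∀ᶠ δ in 𝓝[>] (0:ℝ), (Λ δ).IsZdAdmissible) →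
    ∀ K : Set ℂ, IsCompact K → K ⊆ D.carrier → ∀ ε > (0:ℝ), ∃ η > (0:ℝ), ∀ᶠ δ in 𝓝[>] (0:ℝ),
    ∀ v f w : Site 2, IsCorner v f → meshPoint δ v ∈ K → meshPoint δ (v + w) ∈ K →
    dist (meshPoint δ v) (meshPoint δ (v + w)) < η →
    ‖cornerObs (Λ δ) δ v f - cornerObs (shiftData (Λ δ) (-w)) δ v f‖ ≤ ε * δ ^ ((1:ℝ) / 3)

/-- Dictionary, observable: the qkz corner observable is this file's `cornerObsAt` (argument order). -/
theorem cornerObs_eq (E : DiscreteDobrushin) (δ : ℝ) (v f : Site 2) :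
    cornerObs E δ v f = cornerObsAt δ E v f := rfl

/-- Dictionary, data: the qkz shift of the data is this file's `translateData`. -/
theorem shiftData_eq (E : DiscreteDobrushin) (w : Site 2) : shiftData E w = translateData E w := rfl

end Qkz

/-- Admissibility transport under lattice translation of the data — the part of
`Sig.stub_translationCovariance` the bridge consumes (needed to feed the translated datum to the
local inner envelope). -/
def AdmissibilityTransport : Prop :=
  ∀ (E : DiscreteDobrushin) (w : Site 2), E.IsZdAdmissible → (translateData E w).IsZdAdmissible

/-- The registered covariance stub contains the admissibility transport. -/
theorem admissibilityTransport_of_translationCovariance :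
    Sig.stub_translationCovariance → AdmissibilityTransport :=
  fun hTC E w hE => ((hTC E w).1).2 hE

/-- **Bridge (sharp form).** Admissibility transport + the local inner envelope (LIE) + shift-coupling
locality (SCL) give the picked line's `ShiftStability` — no covariance rewrite and no
`UniformInnerEnvelope` are used. Proof = clause (ii) of `EdgePrecompact_of` with the shift vector `-w`:
SCL carries the difference onto an exterior-measurable `B` with `P(B) ≤ ε'`, LIE bounds both restricted
integrals by `(C ε' + ε₁)(δ/ρ)^{1/3}`, `ρ = ρ_K`. -/
theorem shiftStability_of' :
    AdmissibilityTransport → Sig.stub_localInnerEnvelope → Sig.stub_shiftCouplingLocality →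
      Qkz.ShiftStability := by
  intro hAT hLIE hSCL D Λ hΩ hδ hadm K hK hKD ε hε
  -- a uniform inner radius for K (interiority of K is load-bearing: Disproof (a))
  obtain ⟨r, hr, hrK⟩ := hK.exists_cthickening_subset_open D.isOpen hKD
  set ρ : ℝ := r / 2 with hρdef
  have hρ : 0 < ρ := by positivity
  have h2ρ : 2 * ρ = r := by rw [hρdef]; ring
  have hρK : Metric.cthickening (2 * ρ) K ⊆ D.carrier := by rw [h2ρ]; exact hrK
  have hρK' : Metric.cthickening ρ K ⊆ D.carrier :=
    (Metric.cthickening_mono (by linarith) K).trans hρK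
  have hpos : ∀ᶠ δ in 𝓝[>] (0:ℝ), 0 < δ := eventually_mem_nhdsWithin
  have hlt : ∀ᶠ δ in 𝓝[>] (0:ℝ), δ < ρ := (eventually_lt_nhds hρ).filter_mono nhdsWithin_le_nhds
  have hsplit : ∀ δ : ℝ, 0 < δ → (δ / ρ) ^ ((1:ℝ) / 3) = δ ^ ((1:ℝ) / 3) / ρ ^ ((1:ℝ) / 3) :=
    fun δ hδ0 => Real.div_rpow hδ0.le hρ.le _
  have hρ3 : 0 < ρ ^ ((1:ℝ) / 3) := Real.rpow_pos_of_pos hρ _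
  have hballK : ∀ (δ : ℝ) (v : Site 2), meshPoint δ v ∈ K →
      Metric.closedBall (meshPoint δ v) ρ ⊆ D.carrier := fun δ v hvK x hx =>
    hρK' (Metric.mem_cthickening_of_dist_le x (meshPoint δ v) ρ K hvK (Metric.mem_closedBall.1 hx))
  -- constants
  set ε₁ : ℝ := ε * ρ ^ ((1:ℝ) / 3) / 4 with hε₁def
  have hε₁ : 0 < ε₁ := by positivity
  obtain ⟨C, hC⟩ := hLIE ε₁ hε₁
  set C₁ : ℝ := max C 1 with hC₁def
  have hC₁pos : 0 < C₁ := lt_of_lt_of_le one_pos (le_max_right _ _)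
  have hCC₁ : C ≤ C₁ := le_max_left _ _
  set ε' : ℝ := ε * ρ ^ ((1:ℝ) / 3) / (4 * C₁) with hε'def
  have hε' : 0 < ε' := by positivity
  obtain ⟨η, hη, hev⟩ := hSCL D Λ hΩ hδ hadm K hK hKD ρ hρ hρK ε' hε'
  refine ⟨min η ρ, lt_min hη hρ, ?_⟩
  filter_upwards [hev, hadm, hpos, hlt] with δ hevδ hadmδ hδpos hδρ
  intro v f w hvf hvK _hvwK hdist
  have hΛδ : (Λ δ).δ = δ := hδ δ
  -- the shift vector of the data is u := -w, of norm dist (δv) (δ(v+w)) < min η ρ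
  have hvw : v - (v + w) = -w := by abel
  have hnormu : ‖meshPoint δ (-w)‖ < min η ρ := by
    rw [← hvw, meshPoint_sub, ← dist_eq_norm]; exact hdist
  have hηu : ‖meshPoint δ (-w)‖ < η := lt_of_lt_of_le hnormu (min_le_left _ _)
  have hρu : ‖meshPoint δ (-w)‖ < ρ := lt_of_lt_of_le hnormu (min_le_right _ _)
  -- coupling locality: the difference is carried by an exterior-measurable event B
  obtain ⟨B, hBmeas, hBprob, hBdiff⟩ := hevδ v f (-w) hvf hvK hηu
  rw [hΛδ] at hBdiff
  -- the inner envelope on B, for the datum Λ δ …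
  have key₀ := hC (Λ δ) hadmδ (by rw [hΛδ]; exact hδpos) v f hvf ρ (by rw [hΛδ]; exact hδρ.le)
    (by rw [hΛδ, hΩ]; exact hballK δ v hvK) B (by rw [hΛδ]; exact hBmeas)
  rw [hΛδ] at key₀
  -- … and for the translated datum (admissible by transport; its ball lies in D + δ(-w))
  have hδT : (translateData (Λ δ) (-w)).δ = δ := hΛδ
  have hball₁ : Metric.closedBall (meshPoint δ v) ρ ⊆ (translateData (Λ δ) (-w)).Ω := by
    intro x hx
    change x ∈ (fun y : ℂ => y + meshPoint (Λ δ).δ (-w)) '' (Λ δ).Ω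
    rw [hΩ, hΛδ]
    refine ⟨x - meshPoint δ (-w), ?_, by simp⟩
    apply hρK
    refine Metric.mem_cthickening_of_dist_le (x - meshPoint δ (-w)) (meshPoint δ v) (2 * ρ) K hvK ?_
    calc dist (x - meshPoint δ (-w)) (meshPoint δ v)
        ≤ dist (x - meshPoint δ (-w)) x + dist x (meshPoint δ v) := dist_triangle _ _ _
      _ = ‖meshPoint δ (-w)‖ + dist x (meshPoint δ v) := by
          rw [dist_eq_norm]; congr 1; simp
      _ ≤ ρ + ρ := add_le_add hρu.le (Metric.mem_closedBall.1 hx)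
      _ = 2 * ρ := by ring
  have key₁ := hC (translateData (Λ δ) (-w)) (hAT (Λ δ) (-w) hadmδ) (by rw [hδT]; exact hδpos) v f
    hvf ρ (by rw [hδT]; exact hδρ.le) (by rw [hδT]; exact hball₁) B (by rw [hδT]; exact hBmeas)
  rw [hδT] at key₁
  -- assemble (the qkz observable and shifted data are this file's, by rfl)
  change ‖cornerObsAt δ (Λ δ) v f - cornerObsAt δ (translateData (Λ δ) (-w)) v f‖ ≤ ε * δ ^ ((1:ℝ) / 3)
  rw [hBdiff]
  have hP : ((bondPercolation (zdGraph 2) half) B).toReal ≤ ε' := hBprob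
  have hP0 : 0 ≤ ((bondPercolation (zdGraph 2) half) B).toReal := ENNReal.toReal_nonneg
  have hX : 0 ≤ (δ / ρ) ^ ((1:ℝ) / 3) := Real.rpow_nonneg (div_nonneg hδpos.le hρ.le) _
  have hCP : C * ((bondPercolation (zdGraph 2) half) B).toReal ≤ C₁ * ε' :=
    (mul_le_mul_of_nonneg_right hCC₁ hP0).trans (mul_le_mul_of_nonneg_left hP hC₁pos.le)
  calc ‖(∫ ω in B, phaseFunctionalAt δ (Λ δ) v f ω ∂(bondPercolation (zdGraph 2) half)) -
          (∫ ω in B, phaseFunctionalAt δ (translateData (Λ δ) (-w)) v f ω ∂(bondPercolation (zdGraph 2) half))‖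
      ≤ ‖∫ ω in B, phaseFunctionalAt δ (Λ δ) v f ω ∂(bondPercolation (zdGraph 2) half)‖ +
          ‖∫ ω in B, phaseFunctionalAt δ (translateData (Λ δ) (-w)) v f ω ∂(bondPercolation (zdGraph 2) half)‖ :=
        norm_sub_le _ _
    _ ≤ (C * ((bondPercolation (zdGraph 2) half) B).toReal + ε₁) * (δ / ρ) ^ ((1:ℝ) / 3) +
          (C * ((bondPercolation (zdGraph 2) half) B).toReal + ε₁) * (δ / ρ) ^ ((1:ℝ) / 3) :=
        add_le_add key₀ key₁
    _ ≤ (C₁ * ε' + ε₁) * (δ / ρ) ^ ((1:ℝ) / 3) + (C₁ * ε' + ε₁) * (δ / ρ) ^ ((1:ℝ) / 3) := by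
        have := mul_le_mul_of_nonneg_right (add_le_add_right hCP ε₁) hX
        linarith
    _ = ε * δ ^ ((1:ℝ) / 3) := by
        rw [hsplit δ hδpos, hε'def, hε₁def]
        field_simp
        ring

/-- **Bridge (stub form).** The three registered stubs of this line give the picked line's
`ShiftStability` outright (hypothesis heads = stub names, as in `EdgePrecompact_of`). -/
theorem shiftStability_of :
    Sig.stub_translationCovariance → Sig.stub_localInnerEnvelope → Sig.stub_shiftCouplingLocality →
      Qkz.ShiftStability :=
  fun hTC => shiftStability_of' (admissibilityTransport_of_translationCovariance hTC)

end Summit.CriticalPhenomena.CardyFormulaZ2.Cruxes.EdgePrecompact.ShiftCouplingPhaseExact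

end
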